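import Summits.BirchSwinnertonDyer.Rank1Residual.Additive.TameBranchTwoValueSimpleZero
import HarnessLib

/-!
# THE EXTRA ZEROS' CONTRIBUTION — Λ-algebra: a RATIONAL divisibility `ι(fE·h) = p^k·B` by a bounded
# series with a first top coefficient bounds the linear coefficient of `fE` by `μ(fE) + ord_p[T¹]B + c`,
# with EQUALITY iff the cofactor has no zeros (cell `b2b-bsdres`, sub-cell additive-p2 =
# X3♯(G-ord)/X4♯(G-ord), gen 29; part 1 of 3)

HONEST FRAMING (cell `b2b-bsdres`, run/shared/lean/b2b/bsd-rank1-residual/, verbatim in every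
file): the goal of the cell is to DELETE the COMBINATION-SHAPED residual classes of the
Birch–Swinnerton-Dyer formula for ALL analytic-rank `≤ 1` elliptic curves over `ℚ` — "full BSD
formula for every rank `≤ 1` curve in class `C`" assembled STRICTLY from published theorems — so
that the rank-`≤ 1` remainder becomes exactly the CONSTRUCTION-SHAPED classes, which are TYPED
(missing-input `Prop`s), NOT attempted. This is not "finishing BSD". Sub-cell additive-p2: the
classes X3♯(G-ord) / X4♯(G-ord) are CONSTRUCTION-SHAPED and stay so; labels / RESIDUAL-MAP marks
UNCHANGED; nothing is booked. Theorems only (pure algebra of `Λ = ℤ_p⟦T⟧`); no definition, no named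
fact, no `sorry`.

## What and why

On defect 3, 4, 6 the typed Kato half of the tame-branch main conjecture is RATIONAL (Delbourgo 2002
(C), `TameBranchRatDvdAt`: `ι g = p^k·B` for some `g ∈ char_Λ X(E/ℚ_∞) = (fE)` and SOME `k ∈ ℕ`). At
rank one every earlier certificate read the case `λ_an = 1` (first top coefficient of `B` at index `1`),
where the leading-term identity of Delbourgo 2002 (B) is `ord Ш[p^∞] + ord Reg_p + ord ∏c + ord ℓ =
μ(fE) + 1 + 2 ord #tors` (gen 20). On the rows with `λ_an ≥ 2` (window: 175a1, 6650bi1, 19950dh1 @5;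
10878bk1, 11760bb1 @7) gen 28 obtained Schneider and `#Ш[p^∞] < ∞` only. This file supplies the
Λ-algebra that turns the rational divisibility into a leading-term INEQUALITY with the extra zeros'
contribution made explicit — no Weierstrass preparation, only eisenstein-p1's `μ`/`pfree`/`λ`
(`X1/MuLambdaAlgebra.lean`) and valuations of single coefficients:

* `le_mu_add_of_iota_eq` / `mu_add_le_of_iota_eq` / **`mu_add_eq_of_iota_eq`**: `ι g = p^k·B` with
  `‖[Tʲ]B‖ ≤ p^c` attained ⟹ **`k = μ(g) + c`** (the unknown exponent of (C) IS `μ` of the image, up to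
  the bound): read at the indices `λ(g)` (`[T^{λ(g)}]g = p^{μ(g)}·unit`) and `n` (`p^{μ(g)} ∣ [Tⁿ]g`).
* **`lam_eq_of_iota_eq_of_firstTop`**: first top of `B` at `n` ⟹ `λ(g) = n` (`= λ_an`).
* **`mu_le_valuation_constantCoeff`**: `μ(h) ≤ ord_p h(0)`, `=` iff `λ(h) = 0` (`h = p^{μ(h)}·H`,
  `H(0) ∈ ℤ_p^× ↔ ord_T(H mod p) = 0`).
* **`valuation_coeff_one_le`**: `g = fE·h`, `fE(0) = 0`, `[T¹]B ≠ 0` ⟹ `[T¹]fE ≠ 0` and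
  **`ord_p[T¹]fE ≤ μ(fE) + ord_p[T¹]B + c`** (`[T¹]g = [T¹]fE·h(0)`, `ord_p[T¹]g = k + ord_p[T¹]B`,
  `k ≤ μ(fE) + μ(h) + c`, `μ(h) ≤ ord_p h(0)`);
* **`valuation_coeff_one_eq_iff`**: with the bound attained, **`=` iff `λ(fE) = λ(g)`** (`λ(h) = 0`).

Parts 2–3 (`TameBranchExtraZerosRankOne`, `TameBranchExtraZerosCertificate`) join this with Delbourgo
2002 (B)/(C), Delbourgo 1998 Thm 1 and the census inputs (two values + one Riemann sum). Nothing booked;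
labels UNCHANGED.

References: Washington, GTM 83 §7.1 [Washington1997]; Delbourgo 2002 Thm. (C) p. 40 [Delbourgo2002];
`X1/MuLambdaAlgebra.lean`, `X1/RankOneParitySqueeze.lean` (eisenstein-p1), `X11a/LambdaNorm.lean` (x11a),
`TwistPartnerForcedCertificateBound.lean` (gen 24). -/

set_option autoImplicit false

noncomputable section

open scoped Classical MatrixGroups ModularForm NumberField

open CongruenceSubgroup IsDedekindDomain WeierstrassCurve NumberField
  Literature.NumberTheory.EllipticCurves
  Literature.NumberTheory.EllipticCurves.ModularForms
  Literature.NumberTheory.EllipticCurves.Rank1Residual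
  Literature.NumberTheory.EllipticCurves.Rank1Residual.Typed
  Literature.NumberTheory.EllipticCurves.Delbourgo2002
  Summit.BirchSwinnertonDyer.Rank1Residual.X1.MuLambda
  Summit.BirchSwinnertonDyer.Rank1Residual.X1.RankOneParitySqueeze
  Summit.BirchSwinnertonDyer.Rank1Residual.X11a.LambdaNorm

namespace Summit.BirchSwinnertonDyer.Rank1Residual.Additive

/-! ### §1 Λ-algebra: the exponent of a rational divisibility, `λ` from the first top, the cofactor -/

namespace TameBranchExtraZeros

section Lambda

variable {p : ℕ} [hp : Fact p.Prime]

/-- For `x ≠ 0` in `ℚ_p`: `‖x‖ ≤ p^c ↔ −c ≤ v_p(x)`. [folklore] -/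
theorem norm_le_pow_iff_neg_le_valuation {x : ℚ_[p]} (hx : x ≠ 0) (c : ℕ) :
    ‖x‖ ≤ (p : ℝ) ^ c ↔ -(c : ℤ) ≤ x.valuation := by
  have h1p : (1 : ℝ) < p := by exact_mod_cast hp.out.one_lt
  rw [Padic.norm_eq_zpow_neg_valuation hx, ← zpow_natCast, zpow_le_zpow_iff_right₀ h1p, neg_le]

/-- For `x ≠ 0` in `ℚ_p`: `‖x‖ = p^c ↔ v_p(x) = −c`. [folklore] -/
theorem norm_eq_pow_iff_valuation_eq {x : ℚ_[p]} (hx : x ≠ 0) (c : ℕ) :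
    ‖x‖ = (p : ℝ) ^ c ↔ x.valuation = -(c : ℤ) := by
  have h1p : (1 : ℝ) < p := by exact_mod_cast hp.out.one_lt
  rw [Padic.norm_eq_zpow_neg_valuation hx, ← zpow_natCast,
    (zpow_right_injective₀ (zero_lt_one.trans h1p) h1p.ne').eq_iff]
  constructor <;> intro h <;> linarith

/-- An element of `ℤ_p` has non-negative valuation in `ℚ_p`. [folklore] -/
theorem valuation_coe_nonneg (x : ℤ_[p]) : 0 ≤ ((x : ℤ_[p]) : ℚ_[p]).valuation :=
  (Padic.norm_le_one_iff_val_nonneg _).mp (by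
    rw [PadicInt.padic_norm_e_of_padicInt]; exact PadicInt.norm_le_one _)

/-- **`k ≤ μ(g) + c`.** If `ι g = p^k · B` with `‖[Tʲ]B‖ ≤ p^c` for all `j`, then `k ≤ μ(g) + c`
(read at the index `λ(g)`, where `[T^{λ(g)}]g = p^{μ(g)}·unit`). [cite: Washington1997, §7.1] -/
theorem le_mu_add_of_iota_eq {g : IwasawaAlgebra p} (hg : g ≠ 0) {k c : ℕ} {B : PowerSeries ℚ_[p]}
    (hι : iwasawaToPowerSeries p g = PowerSeries.C ((p : ℚ_[p]) ^ k) * B)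
    (hbd : ∀ j : ℕ, ‖PowerSeries.coeff j B‖ ≤ (p : ℝ) ^ c) : k ≤ mu g + c := by
  have hpQ : (p : ℚ_[p]) ≠ 0 := Nat.cast_ne_zero.mpr hp.out.ne_zero
  obtain ⟨hne, hval⟩ := valuation_coeff_lam hg
  have hcoef : ((PowerSeries.coeff (lam g) g : ℤ_[p]) : ℚ_[p]) =
      (p : ℚ_[p]) ^ k * PowerSeries.coeff (lam g) B := by
    rw [← Wuthrich2014.coeff_iwasawaToPowerSeries p g (lam g), hι, PowerSeries.coeff_C_mul]
  have hB0 : PowerSeries.coeff (lam g) B ≠ 0 := by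
    intro h0; rw [h0, mul_zero] at hcoef; exact hne hcoef
  have hvB : -(c : ℤ) ≤ (PowerSeries.coeff (lam g) B).valuation :=
    (norm_le_pow_iff_neg_le_valuation hB0 c).mp (hbd _)
  have hv : (mu g : ℤ) = k + (PowerSeries.coeff (lam g) B).valuation := by
    rw [← hval, hcoef, Padic.valuation_mul (pow_ne_zero _ hpQ) hB0, Padic.valuation_pow,
      Padic.valuation_p, mul_one]
  omega

/-- **`μ(g) + c ≤ k` when the bound is attained.** If `ι g = p^k · B` and `‖[Tⁿ]B‖ = p^c` for some
`n`, then `μ(g) + c ≤ k` (`p^{μ(g)} ∣ [Tⁿ]g = p^k[Tⁿ]B`). [cite: Washington1997, §7.1] -/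
theorem mu_add_le_of_iota_eq {g : IwasawaAlgebra p} {k c : ℕ} {B : PowerSeries ℚ_[p]}
    (hι : iwasawaToPowerSeries p g = PowerSeries.C ((p : ℚ_[p]) ^ k) * B)
    {n : ℕ} (hn : ‖PowerSeries.coeff n B‖ = (p : ℝ) ^ c) : mu g + c ≤ k := by
  have hpQ : (p : ℚ_[p]) ≠ 0 := Nat.cast_ne_zero.mpr hp.out.ne_zero
  have hcoefZ : PowerSeries.coeff n g = (p : ℤ_[p]) ^ mu g * PowerSeries.coeff n (pfree g) := by
    conv_lhs => rw [eq_C_pow_mu_mul_pfree g]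
    rw [PowerSeries.coeff_C_mul]
  have hcoef : ((PowerSeries.coeff n g : ℤ_[p]) : ℚ_[p]) = (p : ℚ_[p]) ^ k * PowerSeries.coeff n B := by
    rw [← Wuthrich2014.coeff_iwasawaToPowerSeries p g n, hι, PowerSeries.coeff_C_mul]
  have hB0 : PowerSeries.coeff n B ≠ 0 := by
    intro h0
    rw [h0, norm_zero] at hn
    exact (pow_pos (show (0 : ℝ) < p by exact_mod_cast hp.out.pos) c).ne hn
  have hvB : (PowerSeries.coeff n B).valuation = -(c : ℤ) :=
    (norm_eq_pow_iff_valuation_eq hB0 c).mp hn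
  have hx0 : ((PowerSeries.coeff n (pfree g) : ℤ_[p]) : ℚ_[p]) ≠ 0 := by
    intro h0
    have h1 : ((PowerSeries.coeff n g : ℤ_[p]) : ℚ_[p]) = 0 := by
      rw [hcoefZ]; push_cast; rw [h0, mul_zero]
    rw [hcoef] at h1
    exact (mul_ne_zero (pow_ne_zero _ hpQ) hB0) h1
  have hxv := valuation_coe_nonneg (PowerSeries.coeff n (pfree g))
  have h1 : (((PowerSeries.coeff n g : ℤ_[p]) : ℚ_[p])).valuation =
      mu g + ((PowerSeries.coeff n (pfree g) : ℤ_[p]) : ℚ_[p]).valuation := by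
    rw [hcoefZ]; push_cast
    rw [Padic.valuation_mul (pow_ne_zero _ hpQ) hx0, Padic.valuation_pow, Padic.valuation_p, mul_one]
  have h2 : (((PowerSeries.coeff n g : ℤ_[p]) : ℚ_[p])).valuation = k + -(c : ℤ) := by
    rw [hcoef, Padic.valuation_mul (pow_ne_zero _ hpQ) hB0, Padic.valuation_pow, Padic.valuation_p,
      mul_one, hvB]
  omega

/-- **`μ(g) + c = k`**: `ι g = p^k·B`, `B` bounded by `p^c` and attaining it. [cite: Washington1997, §7.1] -/
theorem mu_add_eq_of_iota_eq {g : IwasawaAlgebra p} (hg : g ≠ 0) {k c : ℕ} {B : PowerSeries ℚ_[p]}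
    (hι : iwasawaToPowerSeries p g = PowerSeries.C ((p : ℚ_[p]) ^ k) * B)
    (hbd : ∀ j : ℕ, ‖PowerSeries.coeff j B‖ ≤ (p : ℝ) ^ c)
    {n : ℕ} (hn : ‖PowerSeries.coeff n B‖ = (p : ℝ) ^ c) : mu g + c = k :=
  le_antisymm (mu_add_le_of_iota_eq hι hn) (le_mu_add_of_iota_eq hg hι hbd)

/-- **`λ(g)` is the first top index of `B`.** `ι g = p^k·B`, `‖[Tʲ]B‖ ≤ p^c` for all `j`,
`‖[Tⁿ]B‖ = p^c` and `‖[Tⁱ]B‖ < p^c` for `i < n` ⟹ `λ(g) = n`. [cite: Washington1997, §7.1] -/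
theorem lam_eq_of_iota_eq_of_firstTop {g : IwasawaAlgebra p} (hg : g ≠ 0) {k c : ℕ}
    {B : PowerSeries ℚ_[p]}
    (hι : iwasawaToPowerSeries p g = PowerSeries.C ((p : ℚ_[p]) ^ k) * B)
    (hbd : ∀ j : ℕ, ‖PowerSeries.coeff j B‖ ≤ (p : ℝ) ^ c)
    {n : ℕ} (hn : ‖PowerSeries.coeff n B‖ = (p : ℝ) ^ c)
    (hlt : ∀ i < n, ‖PowerSeries.coeff i B‖ < (p : ℝ) ^ c) : lam g = n := by
  have hpQ : (p : ℚ_[p]) ≠ 0 := Nat.cast_ne_zero.mpr hp.out.ne_zero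
  refine le_antisymm (lam_le_of_dvd_of_iota_eq_C_pow_mul_of_norm_le_pow (dvd_refl g) hι hbd hn) ?_
  by_contra hlt'
  rw [not_le] at hlt'
  have hμ : mu g + c = k := mu_add_eq_of_iota_eq hg hι hbd hn
  obtain ⟨hne, hval⟩ := valuation_coeff_lam hg
  have hcoef : ((PowerSeries.coeff (lam g) g : ℤ_[p]) : ℚ_[p]) =
      (p : ℚ_[p]) ^ k * PowerSeries.coeff (lam g) B := by
    rw [← Wuthrich2014.coeff_iwasawaToPowerSeries p g (lam g), hι, PowerSeries.coeff_C_mul]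
  have hB0 : PowerSeries.coeff (lam g) B ≠ 0 := by
    intro h0; rw [h0, mul_zero] at hcoef; exact hne hcoef
  have hv : (mu g : ℤ) = k + (PowerSeries.coeff (lam g) B).valuation := by
    rw [← hval, hcoef, Padic.valuation_mul (pow_ne_zero _ hpQ) hB0, Padic.valuation_pow,
      Padic.valuation_p, mul_one]
  have hvB : (PowerSeries.coeff (lam g) B).valuation = -(c : ℤ) := by omega
  have hnB : ‖PowerSeries.coeff (lam g) B‖ = (p : ℝ) ^ c :=
    (norm_eq_pow_iff_valuation_eq hB0 c).mpr hvB
  exact absurd hnB (hlt _ hlt').ne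

/-- **`μ(h) ≤ v_p(h(0))`, with equality iff `λ(h) = 0`** (`h ≠ 0`, `h(0) ≠ 0`): `h = p^{μ(h)}·H` with
`H ≢ 0 (mod p)`, `v_p(h(0)) = μ(h) + v_p(H(0))`, and `H(0) ∈ ℤ_p^× ↔ ord_T(H mod p) = 0`.
[cite: Washington1997, §7.1] -/
theorem mu_le_valuation_constantCoeff {h : IwasawaAlgebra p} (hh : h ≠ 0)
    (h0 : ((PowerSeries.constantCoeff h : ℤ_[p]) : ℚ_[p]) ≠ 0) :
    (mu h : ℤ) ≤ ((PowerSeries.constantCoeff h : ℤ_[p]) : ℚ_[p]).valuation ∧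
      ((mu h : ℤ) = ((PowerSeries.constantCoeff h : ℤ_[p]) : ℚ_[p]).valuation ↔ lam h = 0) := by
  have hpQ : (p : ℚ_[p]) ≠ 0 := Nat.cast_ne_zero.mpr hp.out.ne_zero
  have hcZ : PowerSeries.constantCoeff h =
      (p : ℤ_[p]) ^ mu h * PowerSeries.constantCoeff (pfree h) := by
    conv_lhs => rw [eq_C_pow_mu_mul_pfree h]
    rw [map_mul, PowerSeries.constantCoeff_C]
  have hH0 : ((PowerSeries.constantCoeff (pfree h) : ℤ_[p]) : ℚ_[p]) ≠ 0 := by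
    intro e; apply h0; rw [hcZ]; push_cast; rw [e, mul_zero]
  have hv : ((PowerSeries.constantCoeff h : ℤ_[p]) : ℚ_[p]).valuation =
      mu h + ((PowerSeries.constantCoeff (pfree h) : ℤ_[p]) : ℚ_[p]).valuation := by
    rw [hcZ]; push_cast
    rw [Padic.valuation_mul (pow_ne_zero _ hpQ) hH0, Padic.valuation_pow, Padic.valuation_p, mul_one]
  have hnn := valuation_coe_nonneg (PowerSeries.constantCoeff (pfree h))
  refine ⟨by rw [hv]; linarith, ?_⟩
  have hred : red (pfree h) ≠ 0 := red_pfree_ne_zero hh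
  -- `v(H(0)) = 0 ↔ λ(h) = 0`
  have key : ((PowerSeries.constantCoeff (pfree h) : ℤ_[p]) : ℚ_[p]).valuation = 0 ↔ lam h = 0 := by
    have e1 : ((PowerSeries.constantCoeff (pfree h) : ℤ_[p]) : ℚ_[p]).valuation = 0 ↔
        ‖PowerSeries.constantCoeff (pfree h)‖ = 1 := by
      have h' := norm_eq_pow_iff_valuation_eq hH0 0
      rw [pow_zero, Nat.cast_zero, neg_zero, PadicInt.padic_norm_e_of_padicInt] at h'
      exact h'.symm
    have e2 : ‖PowerSeries.constantCoeff (pfree h)‖ = 1 ↔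
        PowerSeries.coeff 0 (red (pfree h)) ≠ 0 := by
      rw [Ne, coeff_map_residue_eq_zero_iff, norm_eq_one_iff_not_lt,
        PowerSeries.coeff_zero_eq_constantCoeff_apply]
    have e3 : PowerSeries.coeff 0 (red (pfree h)) ≠ 0 ↔ (red (pfree h)).order = 0 := by
      rw [← Nat.cast_zero (R := ℕ∞), PowerSeries.order_eq_nat]
      simp
    have e4 : (red (pfree h)).order = 0 ↔ lam h = 0 := by
      rw [lam]
      have hne : (red (pfree h)).order ≠ ⊤ := by rwa [Ne, PowerSeries.order_eq_top]
      constructor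
      · intro h0'; rw [h0']; rfl
      · intro h0'
        rcases ENat.toNat_eq_zero.mp h0' with h1 | h1
        · exact h1
        · exact absurd h1 hne
    exact e1.trans (e2.trans (e3.trans e4))
  rw [← key, hv]
  constructor
  · intro e; linarith
  · intro e; rw [e, add_zero]

/-- **THE EXTRA ZEROS' CONTRIBUTION (Λ-algebra core, inequality).** `g = fE·h` in `Λ = ℤ_p⟦T⟧`,
`ι g = p^k·B` with `‖[Tʲ]B‖ ≤ p^c` for all `j`, `fE(0) = 0` and `[T¹]B ≠ 0`. Then `[T¹]fE ≠ 0`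
(so `ord_T fE = 1`) and **`v_p([T¹]fE) ≤ μ(fE) + v_p([T¹]B) + c`**: `[T¹]g = [T¹]fE·h(0)`,
`v_p([T¹]g) = k + v_p([T¹]B)`, `k ≤ μ(g) + c = μ(fE) + μ(h) + c` and `μ(h) ≤ v_p(h(0))`.
[cite: Washington1997, §7.1] -/
theorem valuation_coeff_one_le {fE h g : IwasawaAlgebra p} (hfac : g = fE * h) {k c : ℕ}
    {B : PowerSeries ℚ_[p]} (hι : iwasawaToPowerSeries p g = PowerSeries.C ((p : ℚ_[p]) ^ k) * B)
    (hbd : ∀ j : ℕ, ‖PowerSeries.coeff j B‖ ≤ (p : ℝ) ^ c)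
    (hf0 : PowerSeries.constantCoeff fE = 0) (hB1 : PowerSeries.coeff 1 B ≠ 0) :
    ((PowerSeries.coeff 1 fE : ℤ_[p]) : ℚ_[p]) ≠ 0 ∧
      (((PowerSeries.coeff 1 fE : ℤ_[p]) : ℚ_[p])).valuation ≤
        mu fE + (PowerSeries.coeff 1 B).valuation + c := by
  have hpQ : (p : ℚ_[p]) ≠ 0 := Nat.cast_ne_zero.mpr hp.out.ne_zero
  -- `[T¹] g = [T¹] fE · h(0)` and `= p^k [T¹] B`
  have h1g : PowerSeries.coeff 1 g = PowerSeries.coeff 1 fE * PowerSeries.constantCoeff h := by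
    rw [hfac]; exact coeff_one_mul_eq_mul_constantCoeff hf0
  have hcoef : ((PowerSeries.coeff 1 g : ℤ_[p]) : ℚ_[p]) = (p : ℚ_[p]) ^ k * PowerSeries.coeff 1 B := by
    rw [← Wuthrich2014.coeff_iwasawaToPowerSeries p g 1, hι, PowerSeries.coeff_C_mul]
  have hg1 : ((PowerSeries.coeff 1 g : ℤ_[p]) : ℚ_[p]) ≠ 0 := by
    rw [hcoef]; exact mul_ne_zero (pow_ne_zero _ hpQ) hB1
  have hg : g ≠ 0 := by
    intro h0; apply hg1; rw [h0]; simp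
  have hfE : fE ≠ 0 := by intro h0; apply hg; rw [hfac, h0, zero_mul]
  have hh : h ≠ 0 := by intro h0; apply hg; rw [hfac, h0, mul_zero]
  have hprod : ((PowerSeries.coeff 1 g : ℤ_[p]) : ℚ_[p]) =
      ((PowerSeries.coeff 1 fE : ℤ_[p]) : ℚ_[p]) * ((PowerSeries.constantCoeff h : ℤ_[p]) : ℚ_[p]) := by
    rw [h1g]; push_cast; rfl
  have hf1 : ((PowerSeries.coeff 1 fE : ℤ_[p]) : ℚ_[p]) ≠ 0 := by
    intro e; apply hg1; rw [hprod, e, zero_mul]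
  have hh0 : ((PowerSeries.constantCoeff h : ℤ_[p]) : ℚ_[p]) ≠ 0 := by
    intro e; apply hg1; rw [hprod, e, mul_zero]
  refine ⟨hf1, ?_⟩
  have hv1 : (((PowerSeries.coeff 1 fE : ℤ_[p]) : ℚ_[p])).valuation +
      ((PowerSeries.constantCoeff h : ℤ_[p]) : ℚ_[p]).valuation = k + (PowerSeries.coeff 1 B).valuation := by
    rw [← Padic.valuation_mul hf1 hh0, ← hprod, hcoef, Padic.valuation_mul (pow_ne_zero _ hpQ) hB1,
      Padic.valuation_pow, Padic.valuation_p, mul_one]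
  have hk : k ≤ mu g + c := le_mu_add_of_iota_eq hg hι hbd
  have hμ : mu g = mu fE + mu h := by rw [hfac]; exact mu_mul hfE hh
  have hh0v := (mu_le_valuation_constantCoeff hh hh0).1
  omega

/-- **THE EXTRA ZEROS' CONTRIBUTION (Λ-algebra core, equality criterion).** In the setting of
`valuation_coeff_one_le`, if moreover `B` ATTAINS its bound (`‖[Tⁿ]B‖ = p^c` for some `n`), then
**`v_p([T¹]fE) = μ(fE) + v_p([T¹]B) + c ↔ λ(fE) = λ(g)`** (`↔ λ(h) = 0`: the cofactor has no zeros).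
[cite: Washington1997, §7.1] -/
theorem valuation_coeff_one_eq_iff {fE h g : IwasawaAlgebra p} (hfac : g = fE * h) {k c : ℕ}
    {B : PowerSeries ℚ_[p]} (hι : iwasawaToPowerSeries p g = PowerSeries.C ((p : ℚ_[p]) ^ k) * B)
    (hbd : ∀ j : ℕ, ‖PowerSeries.coeff j B‖ ≤ (p : ℝ) ^ c)
    {n : ℕ} (hn : ‖PowerSeries.coeff n B‖ = (p : ℝ) ^ c)
    (hf0 : PowerSeries.constantCoeff fE = 0) (hB1 : PowerSeries.coeff 1 B ≠ 0) :
    (((PowerSeries.coeff 1 fE : ℤ_[p]) : ℚ_[p])).valuation =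
        mu fE + (PowerSeries.coeff 1 B).valuation + c ↔ lam fE = lam g := by
  have hpQ : (p : ℚ_[p]) ≠ 0 := Nat.cast_ne_zero.mpr hp.out.ne_zero
  have h1g : PowerSeries.coeff 1 g = PowerSeries.coeff 1 fE * PowerSeries.constantCoeff h := by
    rw [hfac]; exact coeff_one_mul_eq_mul_constantCoeff hf0
  have hcoef : ((PowerSeries.coeff 1 g : ℤ_[p]) : ℚ_[p]) = (p : ℚ_[p]) ^ k * PowerSeries.coeff 1 B := by
    rw [← Wuthrich2014.coeff_iwasawaToPowerSeries p g 1, hι, PowerSeries.coeff_C_mul]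
  have hg1 : ((PowerSeries.coeff 1 g : ℤ_[p]) : ℚ_[p]) ≠ 0 := by
    rw [hcoef]; exact mul_ne_zero (pow_ne_zero _ hpQ) hB1
  have hg : g ≠ 0 := by
    intro h0; apply hg1; rw [h0]; simp
  have hfE : fE ≠ 0 := by intro h0; apply hg; rw [hfac, h0, zero_mul]
  have hh : h ≠ 0 := by intro h0; apply hg; rw [hfac, h0, mul_zero]
  have hprod : ((PowerSeries.coeff 1 g : ℤ_[p]) : ℚ_[p]) =
      ((PowerSeries.coeff 1 fE : ℤ_[p]) : ℚ_[p]) * ((PowerSeries.constantCoeff h : ℤ_[p]) : ℚ_[p]) := by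
    rw [h1g]; push_cast; rfl
  have hf1 : ((PowerSeries.coeff 1 fE : ℤ_[p]) : ℚ_[p]) ≠ 0 := by
    intro e; apply hg1; rw [hprod, e, zero_mul]
  have hh0 : ((PowerSeries.constantCoeff h : ℤ_[p]) : ℚ_[p]) ≠ 0 := by
    intro e; apply hg1; rw [hprod, e, mul_zero]
  have hv1 : (((PowerSeries.coeff 1 fE : ℤ_[p]) : ℚ_[p])).valuation +
      ((PowerSeries.constantCoeff h : ℤ_[p]) : ℚ_[p]).valuation = k + (PowerSeries.coeff 1 B).valuation := by
    rw [← Padic.valuation_mul hf1 hh0, ← hprod, hcoef, Padic.valuation_mul (pow_ne_zero _ hpQ) hB1,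
      Padic.valuation_pow, Padic.valuation_p, mul_one]
  have hk : mu g + c = k := mu_add_eq_of_iota_eq hg hι hbd hn
  have hμ : mu g = mu fE + mu h := by rw [hfac]; exact mu_mul hfE hh
  have hlam : lam g = lam fE + lam h := by rw [hfac]; exact lam_mul hfE hh
  obtain ⟨hle, hiff⟩ := mu_le_valuation_constantCoeff hh hh0
  constructor
  · intro e
    have : (mu h : ℤ) = ((PowerSeries.constantCoeff h : ℤ_[p]) : ℚ_[p]).valuation := by omega
    rw [hlam, hiff.mp this, add_zero]
  · intro e
    have hl0 : lam h = 0 := by omega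
    have := hiff.mpr hl0
    omega

end Lambda

end TameBranchExtraZeros

end Summit.BirchSwinnertonDyer.Rank1Residual.Additive

end
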